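import Mathlib
import HarnessLib
import Summits.Ventures.LatticeQCDFlow.Scoring.AsymptoticCoverage

/-!
# STUDENT'S `t_{a−1}` CALIBRATION TENDS TO THE NORMAL ONE AS THE NUMBER OF BATCHES GROWS:
# `lim_{a→∞} N(0,1)^{⊗a}{g | a·ḡ² ≤ z²·s²(g)} = N(0,1)([−z, z])`

HONEST FRAMING: exact (Metropolis-corrected) sampling algorithms for lattice gauge theory;
figures of merit are autocorrelation/cost numbers at stated couplings and volumes; no
continuum-physics claim.

Venture `LatticeQCDFlow` (cell pub-lqcd), topic `Scoring`; FANOUT row 4 (`s0-u1-b`, GEN-32).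
NEW WORK of the cell (classical; not in Mathlib), no definition, nothing cited as a fact.

With a FIXED number `a` of batches (or of independent replicas) the batch-means interval
`x̄ ± z·√(σ̂²/n)` is NOT asymptotically `N(0,1)([−z, z])`-calibrated: its coverage tends to the
Student-type Gaussian functional `N(0,1)^{⊗a}{g | a·ḡ² ≤ z²·s²(g)}` (`ḡ` the mean, `s²(g)` the
unbiased sample variance of `g : Fin a → ℝ`), the limit printed by the cell's fixed-batch-count
coverage theorems.  This file closes the loop with the growing-batch-count calibration
(`Scoring/BatchMeansCLTStudentized.lean`): that functional tends to `N(0,1)([−z, z])` as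
`a → ∞` — Student's `t_{a−1}` law tends to the standard normal one, stated on the event itself so
that no Student density is needed.

Proof (elementary, on ONE probability space).  On `Ω = ℕ → ℝ` with the infinite product
`P = N(0,1)^{⊗ℕ}` (Mathlib's `Measure.infinitePi`) the first `a` coordinates have law
`N(0,1)^{⊗a}`, so the functional is `P(Nₐ² ≤ z²·Vₐ)` with `Nₐ = (∑_{i<a} ωᵢ)/√a` — of law EXACTLY
`N(0,1)` for every `a ≥ 1` (sum of independent Gaussians) — and `Vₐ` the sample variance of the
first `a` coordinates, which tends to `1` almost surely by the strong law of large numbers applied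
to `ωᵢ` and to `ωᵢ²`.  Slutsky (`TendstoInDistribution.continuous_comp_prodMk_of_tendstoInMeasure_const`)
gives `Nₐ² − z²·Vₐ ⇒ Z² − z²`, and `{· ≤ 0}` is a continuity set of the atomless-at-`±z` limit
(portmanteau, `Scoring/AsymptoticCoverage.lean`).

## Content

* `infinitePi_gaussian_hasLaw_truncate` — under `N(0,1)^{⊗ℕ}` the map `ω ↦ (ω 0, …, ω (a−1))`
  has law `N(0,1)^{⊗a}`.
* `infinitePi_gaussian_hasLaw_scaledSum` — `(∑_{i<a} ωᵢ)/√a` has law `N(0,1)` (`1 ≤ a`).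
* `infinitePi_gaussian_sampleVariance_tendsto_ae` — `Vₐ → 1` almost surely.
* **`pi_gaussianReal_student_tendsto_gaussian`** — the headline limit.

Depends on: `Scoring/AsymptoticCoverage` (portmanteau on a continuity set) and Mathlib
(`Measure.infinitePi`, `iIndepFun_infinitePi`, `strong_law_ae_real`,
`gaussianReal_add_gaussianReal_of_indepFun`, Slutsky).  [ours] throughout; the limit statement is
the classical fact that Student's `t_ν` law tends to `N(0,1)` as `ν → ∞`, proved here without
densities.
-/

open MeasureTheory ProbabilityTheory Filter Topology

namespace Summit.Ventures.LatticeQCDFlow.Scoring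

/-! ## §1 The infinite Gaussian product and its first `a` coordinates -/

section Product

/-- Under `N(0,1)^{⊗ℕ}` the coordinates are independent. [ours] (Mathlib's
`iIndepFun_infinitePi`.) -/
theorem infinitePi_gaussian_iIndepFun_eval :
    iIndepFun (fun (i : ℕ) (ω : ℕ → ℝ) => ω i)
      (Measure.infinitePi fun _ : ℕ => gaussianReal 0 1) :=
  iIndepFun_infinitePi (P := fun _ : ℕ => gaussianReal 0 1) (X := fun _ x => x)
    (fun _ => measurable_id)

/-- Each coordinate has law `N(0,1)`. [ours] -/
theorem infinitePi_gaussian_hasLaw_eval (i : ℕ) :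
    HasLaw (fun ω : ℕ → ℝ => ω i) (gaussianReal 0 1)
      (Measure.infinitePi fun _ : ℕ => gaussianReal 0 1) :=
  ⟨(measurable_pi_apply i).aemeasurable, Measure.infinitePi_map_eval _ i⟩

/-- **The first `a` coordinates of `N(0,1)^{⊗ℕ}` have law `N(0,1)^{⊗a}`.** [ours] -/
theorem infinitePi_gaussian_hasLaw_truncate (a : ℕ) :
    HasLaw (fun (ω : ℕ → ℝ) (j : Fin a) => ω (j : ℕ))
      (Measure.pi fun _ : Fin a => gaussianReal 0 1)
      (Measure.infinitePi fun _ : ℕ => gaussianReal 0 1) := by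
  set P := Measure.infinitePi fun _ : ℕ => gaussianReal 0 1 with hP
  have hind : iIndepFun (fun (j : Fin a) (ω : ℕ → ℝ) => ω (j : ℕ)) P :=
    infinitePi_gaussian_iIndepFun_eval.precomp Fin.val_injective
  have hmeas : ∀ j : Fin a, AEMeasurable (fun ω : ℕ → ℝ => ω (j : ℕ)) P := fun j =>
    (measurable_pi_apply _).aemeasurable
  refine ⟨(measurable_pi_lambda _ fun j => measurable_pi_apply _).aemeasurable, ?_⟩
  rw [(iIndepFun_iff_map_fun_eq_pi_map hmeas).1 hind]
  congr 1
  funext j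
  exact (infinitePi_gaussian_hasLaw_eval (j : ℕ)).map_eq

end Product

/-! ## §2 The scaled sum of the first `a` coordinates is EXACTLY standard normal -/

section ScaledSum

/-- The sum of the first `a` coordinates of `N(0,1)^{⊗ℕ}` has law `N(0, a)`. [ours] -/
theorem infinitePi_gaussian_map_sum_range (a : ℕ) :
    (Measure.infinitePi fun _ : ℕ => gaussianReal 0 1).map
        (fun ω : ℕ → ℝ => ∑ i ∈ Finset.range a, ω i) = gaussianReal 0 (a : NNReal) := by
  set P := Measure.infinitePi fun _ : ℕ => gaussianReal 0 1 with hP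
  induction a with
  | zero =>
    simp only [Finset.range_zero, Finset.sum_empty, Nat.cast_zero, gaussianReal_zero_var]
    rw [Measure.map_const, measure_univ, one_smul]
  | succ n ih =>
    have hfun : (fun ω : ℕ → ℝ => ∑ i ∈ Finset.range (n + 1), ω i)
        = (∑ i ∈ Finset.range n, fun ω : ℕ → ℝ => ω i) + fun ω => ω n := by
      funext ω
      simp only [Finset.sum_range_succ, Pi.add_apply, Finset.sum_apply]
    have hind : IndepFun (∑ i ∈ Finset.range n, fun ω : ℕ → ℝ => ω i) (fun ω : ℕ → ℝ => ω n) P :=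
      infinitePi_gaussian_iIndepFun_eval.indepFun_finsetSum_of_notMem
        (fun i => measurable_pi_apply i) (by simp)
    have ih' : P.map (∑ i ∈ Finset.range n, fun ω : ℕ → ℝ => ω i) = gaussianReal 0 (n : NNReal) := by
      rw [← ih]
      congr 1
      funext ω
      simp only [Finset.sum_apply]
    rw [hfun, gaussianReal_add_gaussianReal_of_indepFun hind ih'
      (infinitePi_gaussian_hasLaw_eval n).map_eq, add_zero, Nat.cast_succ]

/-- **`(∑_{i<a} ωᵢ)/√a` has law EXACTLY `N(0,1)` under `N(0,1)^{⊗ℕ}`, for every `a ≥ 1`.** [ours] -/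
theorem infinitePi_gaussian_hasLaw_scaledSum {a : ℕ} (ha : 1 ≤ a) :
    HasLaw (fun ω : ℕ → ℝ => (∑ i ∈ Finset.range a, ω i) / Real.sqrt a) (gaussianReal 0 1)
      (Measure.infinitePi fun _ : ℕ => gaussianReal 0 1) := by
  have hS : HasLaw (fun ω : ℕ → ℝ => ∑ i ∈ Finset.range a, ω i) (gaussianReal 0 (a : NNReal))
      (Measure.infinitePi fun _ : ℕ => gaussianReal 0 1) :=
    ⟨(Finset.measurable_sum _ fun i _ => measurable_pi_apply i).aemeasurable,
      infinitePi_gaussian_map_sum_range a⟩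
  have h := gaussianReal_div_const hS (Real.sqrt a)
  rw [zero_div] at h
  have haR : (0 : ℝ) < a := by exact_mod_cast ha
  convert h using 2
  apply NNReal.eq
  rw [NNReal.coe_div, NNReal.coe_natCast, NNReal.coe_mk, Real.sq_sqrt haR.le, NNReal.coe_one,
    div_self haR.ne']

end ScaledSum

/-! ## §3 The sample variance of the first `a` coordinates tends to `1` almost surely -/

section SampleVariance

/-- The strong law for the coordinates of `N(0,1)^{⊗ℕ}`: `(∑_{i<n} ωᵢ)/n → 0` a.s. [ours] -/
theorem infinitePi_gaussian_mean_tendsto_ae :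
    ∀ᵐ ω ∂(Measure.infinitePi fun _ : ℕ => gaussianReal 0 1),
      Tendsto (fun n : ℕ => (∑ i ∈ Finset.range n, ω i) / (n : ℝ)) atTop (𝓝 (0 : ℝ)) := by
  set P := Measure.infinitePi fun _ : ℕ => gaussianReal 0 1 with hP
  have hlaw := infinitePi_gaussian_hasLaw_eval (i := 0)
  have hint : Integrable (fun ω : ℕ → ℝ => ω 0) P := by
    have h1 : Integrable (fun y : ℝ => y) (P.map fun ω : ℕ → ℝ => ω 0) := by
      rw [hlaw.map_eq]
      exact (memLp_id_gaussianReal' 1 ENNReal.one_ne_top).integrable le_rfl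
    exact h1.comp_measurable (measurable_pi_apply 0)
  have hid : ∀ i, IdentDistrib (fun ω : ℕ → ℝ => ω i) (fun ω : ℕ → ℝ => ω 0) P P := fun i =>
    { aemeasurable_fst := (measurable_pi_apply i).aemeasurable
      aemeasurable_snd := (measurable_pi_apply 0).aemeasurable
      map_eq := by rw [(infinitePi_gaussian_hasLaw_eval i).map_eq, hlaw.map_eq] }
  have h := strong_law_ae_real (fun (i : ℕ) (ω : ℕ → ℝ) => ω i) hint
    (fun i j hij => infinitePi_gaussian_iIndepFun_eval.indepFun hij) hid
  have hmean : ∫ ω : ℕ → ℝ, ω 0 ∂P = 0 := by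
    rw [hlaw.integral_eq, integral_id_gaussianReal]
  rw [hmean] at h
  exact h

/-- The strong law for the squared coordinates: `(∑_{i<n} ωᵢ²)/n → 1` a.s. [ours] -/
theorem infinitePi_gaussian_meanSq_tendsto_ae :
    ∀ᵐ ω ∂(Measure.infinitePi fun _ : ℕ => gaussianReal 0 1),
      Tendsto (fun n : ℕ => (∑ i ∈ Finset.range n, ω i ^ 2) / (n : ℝ)) atTop (𝓝 (1 : ℝ)) := by
  set P := Measure.infinitePi fun _ : ℕ => gaussianReal 0 1 with hP
  have hlaw := infinitePi_gaussian_hasLaw_eval (i := 0)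
  have hint : Integrable (fun ω : ℕ → ℝ => ω 0 ^ 2) P := by
    have h1 : Integrable (fun y : ℝ => y ^ 2) (P.map fun ω : ℕ → ℝ => ω 0) := by
      rw [hlaw.map_eq]
      exact (memLp_id_gaussianReal' 2 ENNReal.ofNat_ne_top).integrable_sq
    exact h1.comp_measurable (measurable_pi_apply 0)
  have hsqm : Measurable fun y : ℝ => y ^ 2 := by fun_prop
  have hid : ∀ i, IdentDistrib (fun ω : ℕ → ℝ => ω i ^ 2) (fun ω : ℕ → ℝ => ω 0 ^ 2) P P := fun i =>
    { aemeasurable_fst := ((measurable_pi_apply i).pow_const 2).aemeasurable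
      aemeasurable_snd := ((measurable_pi_apply 0).pow_const 2).aemeasurable
      map_eq := by
        have e : ∀ k : ℕ, (fun ω : ℕ → ℝ => ω k ^ 2) = (fun y : ℝ => y ^ 2) ∘ fun ω : ℕ → ℝ => ω k :=
          fun k => rfl
        rw [e i, e 0, ← Measure.map_map hsqm (measurable_pi_apply i),
          ← Measure.map_map hsqm (measurable_pi_apply 0),
          (infinitePi_gaussian_hasLaw_eval i).map_eq, hlaw.map_eq] }
  have h := strong_law_ae_real (fun (i : ℕ) (ω : ℕ → ℝ) => ω i ^ 2) hint
    (fun i j hij => (infinitePi_gaussian_iIndepFun_eval.indepFun hij).comp hsqm hsqm) hid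
  have hmean : ∫ ω : ℕ → ℝ, ω 0 ^ 2 ∂P = 1 := by
    have h1 : ∫ ω : ℕ → ℝ, ω 0 ^ 2 ∂P = ∫ y : ℝ, y ^ 2 ∂(gaussianReal 0 1) :=
      hlaw.integral_comp (f := fun y : ℝ => y ^ 2) (by fun_prop)
    have h2 : ∫ y : ℝ, y ^ 2 ∂(gaussianReal 0 1) = Var[fun y : ℝ => y; gaussianReal 0 1] :=
      (variance_of_integral_eq_zero aemeasurable_id' (integral_id_gaussianReal)).symm
    rw [h1, h2, variance_fun_id_gaussianReal, NNReal.coe_one]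
  rw [hmean] at h
  exact h

/-- **The sample variance of the first `n` coordinates of `N(0,1)^{⊗ℕ}` tends to `1` almost
surely** (strong law on `ωᵢ` and on `ωᵢ²`, and `n/(n−1) → 1`). [ours] -/
theorem infinitePi_gaussian_sampleVariance_tendsto_ae :
    ∀ᵐ ω ∂(Measure.infinitePi fun _ : ℕ => gaussianReal 0 1),
      Tendsto (fun n : ℕ =>
        (∑ j ∈ Finset.range n, (ω j - (∑ i ∈ Finset.range n, ω i) / (n : ℝ)) ^ 2) / ((n : ℝ) - 1))
        atTop (𝓝 (1 : ℝ)) := by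
  filter_upwards [infinitePi_gaussian_mean_tendsto_ae, infinitePi_gaussian_meanSq_tendsto_ae]
    with ω hA hB
  -- centering identity `∑_{j<n} (x_j − x̄)² = ∑_{j<n} x_j² − (∑_{j<n} x_j)²/n` (folklore; all `n`, with `x/0 = 0`)
  have hcenter : ∀ n : ℕ,
      ∑ j ∈ Finset.range n, (ω j - (∑ i ∈ Finset.range n, ω i) / (n : ℝ)) ^ 2
        = ∑ j ∈ Finset.range n, ω j ^ 2 - (∑ i ∈ Finset.range n, ω i) ^ 2 / (n : ℝ) := by
    intro n
    rcases Nat.eq_zero_or_pos n with hn | hn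
    · subst hn
      simp
    · have hnR : (n : ℝ) ≠ 0 := by exact_mod_cast hn.ne'
      set S := ∑ i ∈ Finset.range n, ω i with hS
      have hexp : ∀ j, (ω j - S / n) ^ 2 = ω j ^ 2 - 2 * (S / n) * ω j + (S / n) ^ 2 := fun j => by
        ring
      simp only [hexp, Finset.sum_add_distrib, Finset.sum_sub_distrib, Finset.sum_const,
        Finset.card_range, nsmul_eq_mul, ← Finset.mul_sum, ← hS]
      field_simp
      ring
  -- rewrite the sample variance as `(Bₙ − Aₙ²) · (n/(n−1))`
  have key : ∀ n : ℕ,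
      (∑ j ∈ Finset.range n, (ω j - (∑ i ∈ Finset.range n, ω i) / (n : ℝ)) ^ 2) / ((n : ℝ) - 1)
        = ((∑ i ∈ Finset.range n, ω i ^ 2) / (n : ℝ) - ((∑ i ∈ Finset.range n, ω i) / (n : ℝ)) ^ 2)
            * ((n : ℝ) / ((n : ℝ) - 1)) := by
    intro n
    rw [hcenter n]
    rcases Nat.eq_zero_or_pos n with hn | hn
    · subst hn
      simp
    · have hnR : (n : ℝ) ≠ 0 := by exact_mod_cast hn.ne'
      rcases eq_or_ne ((n : ℝ) - 1) 0 with h1 | h1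
      · rw [h1, div_zero, div_zero, mul_zero]
      · field_simp
  simp only [key]
  have hratio : Tendsto (fun n : ℕ => (n : ℝ) / ((n : ℝ) - 1)) atTop (𝓝 1) := by
    have h := tendsto_natCast_div_add_atTop (-1 : ℝ)
    refine h.congr fun n => ?_
    rw [sub_eq_add_neg]
  have hlim := ((hB.sub (hA.pow 2)).mul hratio)
  simpa using hlim

end SampleVariance

/-! ## §4 The Student-type Gaussian functional tends to `N(0,1)([−z, z])` -/

section Limit

/-- **STUDENT'S `t_{a−1}` CALIBRATION TENDS TO THE NORMAL ONE.**  For `0 ≤ z`,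
`N(0,1)^{⊗a}{g | a·ḡ² ≤ z²·s²(g)} → N(0,1)([−z, z])` as `a → ∞`, where `ḡ = (∑ᵢ gᵢ)/a` and
`s²(g) = (∑ⱼ (gⱼ − ḡ)²)/(a − 1)`; the event is VERBATIM the limit event of the cell's
fixed-batch-count / fixed-replica-count coverage theorems, so their iterated limit
(`n → ∞`, then the number of batches `a → ∞`) is the nominal `N(0,1)([−z, z])`. [ours] -/
theorem pi_gaussianReal_student_tendsto_gaussian {z : ℝ} (hz : 0 ≤ z) :
    Tendsto (fun a : ℕ => (Measure.pi fun _ : Fin a => gaussianReal 0 1).real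
        {g : Fin a → ℝ | (a : ℝ) * ((∑ i, g i) / (a : ℝ)) ^ 2
            ≤ z ^ 2 * ((∑ j, (g j - (∑ i, g i) / (a : ℝ)) ^ 2) / ((a : ℝ) - 1))})
      atTop (𝓝 ((gaussianReal 0 1).real (Set.Icc (-z) z))) := by
  set P := Measure.infinitePi fun _ : ℕ => gaussianReal 0 1 with hP
  -- the two statistics on the one space `(ℕ → ℝ, P)`
  set N : ℕ → (ℕ → ℝ) → ℝ := fun a ω => (∑ i ∈ Finset.range a, ω i) / Real.sqrt a with hN
  set V : ℕ → (ℕ → ℝ) → ℝ := fun a ω =>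
    (∑ j ∈ Finset.range a, (ω j - (∑ i ∈ Finset.range a, ω i) / (a : ℝ)) ^ 2) / ((a : ℝ) - 1)
    with hV
  have hNm : ∀ a, Measurable (N a) := fun a =>
    (Finset.measurable_sum _ fun i _ => measurable_pi_apply i).div_const _
  have hVm : ∀ a, Measurable (V a) := fun a => by
    refine (Finset.measurable_sum _ fun j _ => ?_).div_const _
    exact ((measurable_pi_apply j).sub
      ((Finset.measurable_sum _ fun i _ => measurable_pi_apply i).div_const _)).pow_const 2
  -- (1) `N a ⇒ Z = id` on `(ℝ, N(0,1))`: the laws are eventually CONSTANT, equal to `N(0,1)`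
  have hND : TendstoInDistribution N atTop (fun y : ℝ => y) (fun _ => P) (gaussianReal 0 1) := by
    refine ⟨fun a => (hNm a).aemeasurable, aemeasurable_id, ?_⟩
    refine tendsto_const_nhds.congr' ?_
    filter_upwards [eventually_ge_atTop 1] with a ha
    apply Subtype.ext
    show (gaussianReal 0 1).map (fun y : ℝ => y) = P.map (N a)
    exact Measure.map_id'.trans (infinitePi_gaussian_hasLaw_scaledSum ha).map_eq.symm
  -- (2) `V a → 1` in probability (from almost surely)
  have hVD : TendstoInMeasure P V atTop (fun _ => (1 : ℝ)) :=
    tendstoInMeasure_of_tendsto_ae (fun a => (hVm a).aestronglyMeasurable)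
      (by
        filter_upwards [infinitePi_gaussian_sampleVariance_tendsto_ae] with ω hω
        exact hω)
  -- (3) Slutsky: `N² − z²·V ⇒ Z² − z²`
  have hφ := hND.continuous_comp_prodMk_of_tendstoInMeasure_const
    (g := fun p : ℝ × ℝ => p.1 ^ 2 - z ^ 2 * p.2) (by fun_prop) hVD (fun a => (hVm a).aemeasurable)
  -- (4) portmanteau on the continuity set `(−∞, 0]`
  have hψm : Measurable fun y : ℝ => (fun p : ℝ × ℝ => p.1 ^ 2 - z ^ 2 * p.2) (y, 1) := by fun_prop
  haveI : NullSingletonClass (gaussianReal 0 1) := nullSingletonClass_gaussianReal one_ne_zero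
  have hfr : ((gaussianReal 0 1).map fun y : ℝ => (fun p : ℝ × ℝ => p.1 ^ 2 - z ^ 2 * p.2) (y, 1))
      (frontier (Set.Iic (0 : ℝ))) = 0 := by
    rw [frontier_Iic, Measure.map_apply hψm (measurableSet_singleton 0)]
    have hsub : (fun y : ℝ => (fun p : ℝ × ℝ => p.1 ^ 2 - z ^ 2 * p.2) (y, 1)) ⁻¹' {0} ⊆ {z, -z} := by
      intro y hy
      simp only [Set.mem_preimage, Set.mem_singleton_iff, mul_one] at hy
      have h2 : y ^ 2 = z ^ 2 := by linarith
      rcases sq_eq_sq_iff_eq_or_eq_neg.1 h2 with h | h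
      · simp [h]
      · simp [h]
    exact measure_mono_null hsub (Set.Countable.measure_zero (Set.toFinite _).countable _)
  have key := CardConsistency.tendsto_measureReal_preimage_of_tendstoInDistribution hφ
    measurableSet_Iic hfr
  -- (5) the limit set is `[−z, z]`
  have hlimset : (fun y : ℝ => (fun p : ℝ × ℝ => p.1 ^ 2 - z ^ 2 * p.2) (y, 1)) ⁻¹' Set.Iic 0
      = Set.Icc (-z) z := by
    ext y
    simp only [Set.mem_preimage, Set.mem_Iic, Set.mem_Icc, mul_one, sub_nonpos]
    rw [sq_le_sq, abs_of_nonneg hz, abs_le]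
  rw [hlimset] at key
  -- (6) for each `a ≥ 1` the functional is the probability of that event
  refine key.congr' ?_
  filter_upwards [eventually_ge_atTop 1] with a ha
  have haR : (0 : ℝ) < a := by exact_mod_cast ha
  have hp : MeasurableSet {g : Fin a → ℝ | (a : ℝ) * ((∑ i, g i) / (a : ℝ)) ^ 2
      ≤ z ^ 2 * ((∑ j, (g j - (∑ i, g i) / (a : ℝ)) ^ 2) / ((a : ℝ) - 1))} :=
    measurableSet_le (by fun_prop) (by fun_prop)
  rw [← (infinitePi_gaussian_hasLaw_truncate a).measureReal_eq
    (p := fun g : Fin a → ℝ => (a : ℝ) * ((∑ i, g i) / (a : ℝ)) ^ 2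
      ≤ z ^ 2 * ((∑ j, (g j - (∑ i, g i) / (a : ℝ)) ^ 2) / ((a : ℝ) - 1))) hp]
  congr 1
  ext ω
  simp only [Set.mem_preimage, Set.mem_Iic, Set.mem_setOf_eq, sub_nonpos]
  rw [Fin.sum_univ_eq_sum_range (fun i => ω i) a,
    Fin.sum_univ_eq_sum_range (fun j => (ω j - (∑ i ∈ Finset.range a, ω i) / (a : ℝ)) ^ 2) a]
  have e : ((∑ i ∈ Finset.range a, ω i) / Real.sqrt a) ^ 2
      = (a : ℝ) * ((∑ i ∈ Finset.range a, ω i) / (a : ℝ)) ^ 2 := by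
    rw [div_pow, div_pow, Real.sq_sqrt haR.le]
    field_simp
  rw [e]

end Limit

end Summit.Ventures.LatticeQCDFlow.Scoring
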